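import Summits.AtomisticToContinuum.HydrodynamicLimit.Theorems.CollisionIsometryCLTCollisionalTransferLocalityVirialBoundedRung0
import Summits.AtomisticToContinuum.HydrodynamicLimit.Theses.InformationPercolationEngine
import HarnessLib

/-!
# [V] `VirialBounded` from the registered item `InformationPercolationEngine.CollisionMomentBound`
(line `hemisphere-affine-slaving`, crux `CollisionalTransferLocality`, stmt-AtomisticToContinuum-9518)

Helper file (`--supports stmt-AtomisticToContinuum-9518`) of the line lead (gen 1, seat c3). The line's open stub [V]
`stub_virialBounded` asked for tightness, under the LOCAL Gibbs laws of nice profiles, of the weighted collision virials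
`V_N(t) = (N+1)⁻¹ Σ_{ordered collisions in (0,t]} ε_N ‖Δv_i‖ (1 + ‖v_i‖ + ‖v_j‖)` (`VirialBounded`, DefsC). This file
shows that [V] is NOT a new statement: it is implied, profile by profile and for every horizon `t > 0` (no pre-shock
restriction, no a-priori window or moment hypothesis), by the support item
`InformationPercolationEngine.CollisionMomentBound` (stmt-AtomisticToContinuum-15144: tightness under the local Gibbs laws of
the velocity-weighted empirical collision functional `K_N[1 + ‖v_i‖² + ‖v_j‖²] =
ε_N (N+1)⁻¹ Σ_{collision times s ∈ [0,τ]} Σ_{ordered contact pairs} (1 + ‖v_i(s)‖² + ‖v_j(s)‖²)`), because the virial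
kernel is dominated by that mark, `virialK ≤ 3 ε_N (1 + ‖v_i‖² + ‖v_j‖²)` (`virialK_le_three_mul`, landed with the
equilibrium rung `virialBounded_const`, whose proof this file repeats with the item in place of its constant-profile
instance `collisionMomentBound_const`).

* `virialBounded_of_collisionMomentBound` — `CollisionMomentBound → ∀ nice profiles ∃ σ₀ ∀ σ < σ₀ ∀ Φ ∀ t > 0,
  VirialBounded σ a₀ θ₀ u₀ Φ t` (pathwise domination `V_N(t) ≤ 3 K_N` on the good set — contact-pair sums as double
  sums, `(0,t] ⊆ [0,t]` — and the local Gibbs law does not charge the bad set).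
Consequence for the line: the skeleton's composition takes stmt-15144 BY NAME instead of the stub [V]
(skeleton v6); the open research content of the line shrinks to [A'-chaos], [B-dyn], [D].
-/

namespace Summit.AtomisticToContinuum.HydrodynamicLimit.Theorems.HemisphereAffineSlaving

open scoped BigOperators Topology Classical ENNReal InnerProductSpace
open Filter Set Function MeasureTheory
open Literature.Analysis.FluidPDE

noncomputable section

open Literature.MathematicalPhysics.KineticTheory (T3 V3 hsDiameter hsDiameter_pos localGibbsLaw)

/-- **[V] from stmt-15144.** The support item `InformationPercolationEngine.CollisionMomentBound` (tightness of the
`(1 + ‖v_i‖² + ‖v_j‖²)`-weighted empirical collision functional under the local Gibbs laws of continuous positive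
profiles, for every flow family and every horizon) implies the line's [V]: for all nice profiles there is `σ₀ > 0`
(the item's) such that for `0 < σ < σ₀`, every flow family `Φ` and every `t > 0`, the weighted collision virials
`V_N(t)` are tight under `localGibbsLaw σ a₀ u₀ θ₀ N (Φ N)` (`VirialBounded`). Proof: on the good set
`V_N(t) ≤ 3 K_N[1 + ‖v_i‖² + ‖v_j‖²]` (`virialK_le_three_mul`, contact-pair sums as double sums over ordered pairs at
distance `ε_N`, collision times in `(0,t] ⊆ [0,t]`), and the bad set is null for the local Gibbs law. -/
theorem virialBounded_of_collisionMomentBound : Summit.AtomisticToContinuum.HydrodynamicLimit.Theses.InformationPercolationEngine.CollisionMomentBound → ∀ (a₀ θ₀ : T3 → ℝ) (u₀ : T3 → V3), NiceProfiles a₀ θ₀ u₀ → ∃ σ₀ : ℝ, 0 < σ₀ ∧ ∀ σ : ℝ, 0 < σ → σ < σ₀ → ∀ (Φ : Flows σ) (t : ℝ), 0 < t → VirialBounded σ a₀ θ₀ u₀ Φ t := by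
  intro hM a₀ θ₀ u₀ hP
  obtain ⟨ha, hθ, hu, ha0, hθ0⟩ := hP
  obtain ⟨σ₀, hσ₀, H⟩ := hM a₀ θ₀ u₀ ha hθ hu ha0 hθ0
  refine ⟨σ₀, hσ₀, fun σ hσ hσlt Φ t ht δ hδ => ?_⟩
  obtain ⟨Kb, N₀, HN⟩ := H σ hσ hσlt Φ t ht δ hδ
  refine ⟨3 * Kb, eventually_atTop.2 ⟨N₀, fun N hN => ?_⟩⟩
  have hε : 0 < hsDiameter σ N := hsDiameter_pos hσ N
  set P := localGibbsLaw σ a₀ u₀ θ₀ N (Φ N) with hP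
  -- the double-sum collision functional of the item (its `let`s unfolded)
  set Kc : Cfg N → ℝ := fun z => hsDiameter σ N / (N + 1 : ℝ) *
      ∑ᶠ (s : ℝ) (_ : s ∈ collisionTimes (Torus.geometry (Fin 3)) (hsDiameter σ N) (fun s => (Φ N).flow s z) ∩ Icc 0 t),
        ∑ i : Fin (N + 1), ∑ j : Fin (N + 1),
          (if i ≠ j ∧ ‖(Torus.geometry (Fin 3)).sepVec ((Φ N).flow s z i).1 ((Φ N).flow s z j).1‖ = hsDiameter σ N
            then 1 + ‖((Φ N).flow s z i).2‖ ^ 2 + ‖((Φ N).flow s z j).2‖ ^ 2 else 0) with hKc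
  have hTle : P {z | Kb < Kc z} ≤ ENNReal.ofReal δ := HN N hN
  -- pathwise: on the good set `V_N(t) ≤ 3 · K_c`
  have hsub : {z : Cfg N | 3 * Kb < virialW σ Φ N z t} ⊆ (Φ N).goodᶜ ∪ {z | Kb < Kc z} := by
    intro z hz
    by_cases hgood : z ∈ (Φ N).good
    · refine Or.inr ?_
      have htraj := (Φ N).isTrajectory z hgood
      have hfin := htraj.finite_collisionTimes_inter_Ioc 0 t
      have hfin' : (collisionTimes (Torus.geometry (Fin 3)) (hsDiameter σ N) (fun s => (Φ N).flow s z) ∩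
          Icc 0 t).Finite := htraj.locFinite 0 t
      -- termwise bound at one collision time, contact-pair sum as a double sum
      have hterm : ∀ s, ∑ p ∈ contactPairs (Torus.geometry (Fin 3)) (hsDiameter σ N) ((Φ N).flow s z),
          virialK σ N s ((Φ N).flow s z) p.1 p.2 ≤
          hsDiameter σ N * (3 * ∑ i : Fin (N + 1), ∑ j : Fin (N + 1),
            (if i ≠ j ∧ ‖(Torus.geometry (Fin 3)).sepVec ((Φ N).flow s z i).1 ((Φ N).flow s z j).1‖ = hsDiameter σ N
              then 1 + ‖((Φ N).flow s z i).2‖ ^ 2 + ‖((Φ N).flow s z j).2‖ ^ 2 else 0)) := by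
        intro s
        have h1 : ∑ p ∈ contactPairs (Torus.geometry (Fin 3)) (hsDiameter σ N) ((Φ N).flow s z),
            virialK σ N s ((Φ N).flow s z) p.1 p.2 ≤
            ∑ p ∈ contactPairs (Torus.geometry (Fin 3)) (hsDiameter σ N) ((Φ N).flow s z),
              hsDiameter σ N * (3 * (1 + ‖((Φ N).flow s z p.1).2‖ ^ 2 + ‖((Φ N).flow s z p.2).2‖ ^ 2)) :=
          Finset.sum_le_sum fun p _ => virialK_le_three_mul hσ N s _ p.1 p.2
        refine h1.trans (le_of_eq ?_)
        rw [sum_contactPairs_eq (htraj.mem s) (fun i j =>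
          hsDiameter σ N * (3 * (1 + ‖((Φ N).flow s z i).2‖ ^ 2 + ‖((Φ N).flow s z j).2‖ ^ 2)))]
        simp only [Finset.mul_sum, mul_ite, mul_zero]
      have hV : virialW σ Φ N z t ≤ 3 * Kc z := by
        rw [hKc]
        dsimp only
        unfold virialW HardSphereFlow.collisionPairSum
        rw [collisionPairSum_eq_finset_sum hfin, finsum_mem_eq_finite_toFinset_sum _ hfin']
        have hsum_le : ∑ s ∈ hfin.toFinset, ∑ p ∈ contactPairs (Torus.geometry (Fin 3)) (hsDiameter σ N)
            ((Φ N).flow s z), virialK σ N s ((Φ N).flow s z) p.1 p.2 ≤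
            ∑ s ∈ hfin'.toFinset, hsDiameter σ N * (3 * ∑ i : Fin (N + 1), ∑ j : Fin (N + 1),
              (if i ≠ j ∧ ‖(Torus.geometry (Fin 3)).sepVec ((Φ N).flow s z i).1 ((Φ N).flow s z j).1‖ =
                  hsDiameter σ N
                then 1 + ‖((Φ N).flow s z i).2‖ ^ 2 + ‖((Φ N).flow s z j).2‖ ^ 2 else 0)) := by
          refine (Finset.sum_le_sum fun s _ => hterm s).trans ?_
          refine Finset.sum_le_sum_of_subset_of_nonneg ?_ fun s _ _ => ?_
          · intro s hs
            rw [Set.Finite.mem_toFinset] at hs ⊢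
            exact ⟨hs.1, hs.2.1.le, hs.2.2⟩
          · refine mul_nonneg hε.le (mul_nonneg (by norm_num) (Finset.sum_nonneg fun i _ =>
              Finset.sum_nonneg fun j _ => ?_))
            split_ifs <;> positivity
        calc ((N : ℝ) + 1)⁻¹ * ∑ s ∈ hfin.toFinset, ∑ p ∈ contactPairs (Torus.geometry (Fin 3)) (hsDiameter σ N)
              ((Φ N).flow s z), virialK σ N s ((Φ N).flow s z) p.1 p.2
            ≤ ((N : ℝ) + 1)⁻¹ * ∑ s ∈ hfin'.toFinset, hsDiameter σ N * (3 * ∑ i : Fin (N + 1), ∑ j : Fin (N + 1),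
              (if i ≠ j ∧ ‖(Torus.geometry (Fin 3)).sepVec ((Φ N).flow s z i).1 ((Φ N).flow s z j).1‖ =
                  hsDiameter σ N
                then 1 + ‖((Φ N).flow s z i).2‖ ^ 2 + ‖((Φ N).flow s z j).2‖ ^ 2 else 0)) :=
              mul_le_mul_of_nonneg_left hsum_le (by positivity)
          _ = _ := by rw [← Finset.mul_sum, ← Finset.mul_sum]; ring
      have h3 : 3 * Kb < 3 * Kc z := lt_of_lt_of_le hz hV
      exact lt_of_mul_lt_mul_left h3 (by norm_num)
    · exact Or.inl hgood
  have hgood0 : P (Φ N).goodᶜ = 0 := localGibbsLaw_compl_good' (Φ N)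
  calc P {z | 3 * Kb < virialW σ Φ N z t} ≤ P ((Φ N).goodᶜ ∪ {z | Kb < Kc z}) := measure_mono hsub
    _ ≤ P (Φ N).goodᶜ + P {z | Kb < Kc z} := measure_union_le _ _
    _ ≤ ENNReal.ofReal δ := by rw [hgood0, zero_add]; exact hTle

/-- **The registered stub [V] from stmt-15144** (its exact registered signature, with the now idle a-priori hypotheses
`ExpMomAt`, kernel admissibility and `WindowAt` simply dropped inside): `CollisionMomentBound → stub_virialBounded`. -/
theorem stub_virialBounded_of_collisionMomentBound
    (hM : Summit.AtomisticToContinuum.HydrodynamicLimit.Theses.InformationPercolationEngine.CollisionMomentBound) :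
    ∀ (a₀ θ₀ : T3 → ℝ) (u₀ : T3 → V3), NiceProfiles a₀ θ₀ u₀ → ∃ σ₀ : ℝ, 0 < σ₀ ∧ ∀ σ : ℝ, 0 < σ → σ < σ₀ → ∀ (Φ : Flows σ) (t : ℝ), 0 < t → ExpMomAt σ a₀ θ₀ u₀ Φ t → ∀ (γ C : ℝ) (φ : ℕ → T3 → ℝ), 0 < γ → γ ≤ 1 / 15 → AdmissibleKernel γ C φ → WindowAt σ a₀ θ₀ u₀ Φ t φ → VirialBounded σ a₀ θ₀ u₀ Φ t := by
  intro a₀ θ₀ u₀ hP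
  obtain ⟨σ₀, hσ₀, H⟩ := virialBounded_of_collisionMomentBound hM a₀ θ₀ u₀ hP
  exact ⟨σ₀, hσ₀, fun σ hσ hlt Φ t ht _ _ _ _ _ _ _ _ => H σ hσ hlt Φ t ht⟩

end

end Summit.AtomisticToContinuum.HydrodynamicLimit.Theorems.HemisphereAffineSlaving
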